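/-
Copyright (c) 2026. All rights reserved.
Released under Apache 2.0 license as described in the file LICENSE.
-/
import Mathlib
import Literature.LinearAlgebra.Matrix.MaximalVolumeErrorBounds

/-!
# Maximum volume submatrices of diagonally dominant matrices can be chosen principal

[CortinovisKressnerMassei2020] A. Cortinovis, D. Kressner, S. Massei, *On maximum volume
submatrices and cross approximation for symmetric semidefinite and diagonally dominant matrices*,
Linear Algebra Appl. 593 (2020) 251–268 (theorem numbering of arXiv:1902.02283, as in
`PosSemidefCrossApproximation` and `DiagonallyDominantCrossApproximation`) — §2.2 (Definition 2:
(row) diagonally dominant, strictly and doubly diagonally dominant matrices; Lemma 3: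
`|det T(I, J)| < |det T(I, I)|` for a strictly DD upper triangular `T` and `I ≠ J`, `|I| = |J|`;
Theorem 4: the maximum volume `k × k` submatrix of a DD matrix can be chosen principal, via the
inequality `|det A(I, J)| ≤ |det A(I, I)|` (2.3); and the remark after its proof: for `k = n - 1`
this is contained in the proof of Theorem 2.5.12 of Horn–Johnson, *Topics in Matrix Analysis*
(1991), resp. in Proposition 2.1 of Peña (2004)); [HornJohnson2013, §6.1 Definition 6.1.9,
Theorem 6.1.10 (a) (Levy–Desplanques: a strictly diagonally dominant matrix is nonsingular) and
Problem 6.1.P16 ("Gaussian elimination preserves strict diagonal dominance"; (a): the principal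
submatrices of a strictly DD matrix are nonsingular)]; [GolubVanLoan2013, §4.1.1 Theorem 4.1.1]
(diagonal dominance is inherited by the Schur complement).

This file completes the formalisation of [CortinovisKressnerMassei2020, §2]: Theorem 1 (the SPSD
case) is `Literature.LinearAlgebra.Matrix.exists_principal_volume_maximal` of
`PosSemidefCrossApproximation`; here we prove Lemma 3 and Theorem 4 (the diagonally dominant
case), over an arbitrary normed field and for index maps `r c : ι → n` in place of index sets.

## Contents

* DOMINANCE MARGINS UNDER ELIMINATION: `norm_diag_sub_sum_erase_norm_le_elim` — one step of
  Gaussian elimination with a pivot `E p p ≠ 0` in a diagonally dominant ROW `p` does not decrease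
  the dominance margin `‖E x x‖ - Σ_{y ≠ x} ‖E x y‖` of any other row `x`; hence strict row
  diagonal dominance is inherited (`sum_erase_norm_sub_mul_inv_mul_lt_norm`, the strict companion
  of `Literature.LinearAlgebra.Matrix.sum_erase_norm_sub_mul_inv_mul_le_norm`).
* THEOREM 4, THE INEQUALITY (2.3): `norm_det_submatrix_le_of_rowDiagDominant` —
  `‖det A[r, c]‖ ≤ ‖det A[r, r]‖` for every row DD matrix `A` and all `r c : ι → n`; the row-local
  form `norm_det_submatrix_le_of_sum_erase_le` only asks the rows `r t` to be dominant; the column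
  version `norm_det_submatrix_le_of_colDiagDominant` (`‖det A[r, c]‖ ≤ ‖det A[c, c]‖`).
* THEOREM 4 AS STATED: `exists_principal_volume_maximal_of_rowDiagDominant` — some principal
  `k × k` block has maximal volume among ALL `k × k` blocks; and
  `norm_det_submatrix_le_of_forall_principal_le_of_rowDiagDominant` — a principal block of maximal
  volume among principal blocks has maximal volume among all blocks.
* LEMMA 3 (GENERALISED — no triangularity): `norm_det_submatrix_lt_of_rowStrictDiagDominant` —
  for a STRICTLY row DD matrix, injective `r` and `Set.range r ≠ Set.range c`,
  `‖det A[r, c]‖ < ‖det A[r, r]‖` (row-local form `norm_det_submatrix_lt_of_sum_erase_lt`);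
  the principal minors are nonzero (`det_submatrix_ne_zero_of_sum_erase_lt`, Levy–Desplanques on
  the block); consequently a block of maximal volume within its rows is principal as a set of
  indices (`range_eq_range_of_volume_maximal_of_rowStrictDiagDominant`).
* PRINCIPAL MAXIMUM-VOLUME CROSS APPROXIMATION (real DD matrices):
  `abs_sub_crossInterp_le_of_principal_volume_maximal_of_rowDiagDominant` — Theorem 4 combined
  with the maximal-volume principle
  (`Literature.LinearAlgebra.Matrix.abs_sub_crossInterp_le_of_volume_maximal`, the entrywise
  `(k+1)²` bound): a nonsingular principal block of maximal volume AMONG PRINCIPAL BLOCKS gives an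
  entrywise quasi-optimal cross approximation `|(A - A[:, I] A(I, I)⁻¹ A[I, :]) i j| ≤ (k+1)² δ`
  for every `F` of rank `≤ k` with `|A - F| ≤ δ`; for strictly DD `A` the nonsingularity is
  automatic (`…_of_rowStrictDiagDominant`).
* THE CASE `k = n - 1`: in every COLUMN of the adjugate, and of the inverse, of a row DD matrix
  the diagonal entry has maximal modulus — `norm_adjugate_apply_le_of_rowDiagDominant`
  (`‖adj A i j‖ ≤ ‖adj A j j‖`), `norm_inv_apply_le_of_rowDiagDominant`
  (`‖A⁻¹ i j‖ ≤ ‖A⁻¹ j j‖`), strict for `i ≠ j` when `A` is strictly row DD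
  (`norm_adjugate_apply_lt_of_rowStrictDiagDominant`, `norm_inv_apply_lt_of_rowStrictDiagDominant`:
  the inverse of a strictly row DD matrix is strictly diagonally dominant OF ITS COLUMN ENTRIES).

## Dictionary (paper ↔ Lean)

* `A(I, J)` with `|I| = |J| = k` ↔ `A.submatrix r c` for index MAPS `r c : ι → n` (`I = range r`,
  `J = range c`, `k = card ι` when `r`, `c` are injective; a non-injective index map gives a block
  with two equal rows or columns, whose determinant vanishes, so no injectivity is assumed unless
  needed); `I ≠ J` ↔ `Set.range r ≠ Set.range c`; volume `|det ·|` ↔ `‖det ·‖`.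
* Definition 2 (row DD / strictly DD) ↔ the hypotheses `∀ i, ∑ j ∈ univ.erase i, ‖A i j‖ ≤ ‖A i i‖`
  / `… < …` (as in Mathlib's `det_ne_zero_of_sum_row_lt_diag` and in
  `DiagonallyDominantCrossApproximation`); column DD ↔ the same for `Aᵀ`.

## Proof

The paper proves Theorem 4 for strictly DD matrices through the LU factorisation (`U` is
strictly DD, Higham, *Accuracy and Stability*, Theorem 9.9) and Lemma 3 for `U`, and passes to DD
matrices by continuity.  We argue directly by induction on `k`, for all matrices at once: with
pivot row `i = r 0`, one step of Gaussian elimination `S = A - A[:, i] (A i i)⁻¹ A[i, :]` leaves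
every minor on the rows `r` unchanged up to its first row (`det A[r, c] = Σ_j ± A i (c j) ·
det S[r ∘ succ, c ∘ j.succAbove]`, Laplace expansion), kills column `i` of `S`, so that
`det A[r, r] = A i i · det S[r ∘ succ, r ∘ succ]` and `det A[r, c] = ± A i i · det S[r ∘ succ, c']`
whenever `i ∈ J`, and preserves (strict) diagonal dominance of the remaining rows with
non-decreasing margins ([HornJohnson2013, 6.1.P16]); if `i ∉ J` the first-row expansion is bounded
by `(Σ_{j ∈ J} ‖A i j‖) · ‖det S[r ∘ succ, r ∘ succ]‖ ≤ ‖A i i‖ · ‖det S[r ∘ succ, r ∘ succ]‖` using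
the induction hypothesis for `S`.  This yields the non-strict case without a limiting argument and
Lemma 3 without triangularity.

## Not formalised

The LU route of the printed proof (existence of `A = LU` with `U` strictly DD for strictly DD `A`,
Higham Theorem 9.9) and the continuity argument; the full statements of Horn–Johnson (1991)
Theorem 2.5.12 and Peña (2004) Proposition 2.1 beyond the column-entry dominance of `adj A` and
`A⁻¹` proved here; doubly DD matrices (for which both `‖det A[r, c]‖ ≤ ‖det A[r, r]‖` and
`≤ ‖det A[c, c]‖` hold by the two theorems above).
-/

namespace Literature.LinearAlgebra.Matrix

open _root_.Matrix Finset

/-! ### One elimination step and the minors on a fixed set of rows -/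

section CommRing

variable {K : Type*} [CommRing K] {n : Type*} {k : ℕ}

/-- [folklore] Laplace expansion of the `(k+1) × (k+1)` minor `det A[r, c]` along its first row
AFTER eliminating the pivot row `i = r 0` from the other rows: if
`S x y = A x y - A x i * q * A i y` (for `q = (A i i)⁻¹` this is one step of Gaussian elimination;
the identity holds for every `q`), then
`det A[r, c] = Σ_j (-1)^j A i (c j) · det S[r ∘ succ, c ∘ j.succAbove]`. -/
private theorem det_submatrix_eq_sum_elim (A S : Matrix n n K) (i : n) (q : K)
    (hS : ∀ x y, S x y = A x y - A x i * q * A i y) (r c : Fin (k + 1) → n) (hr : r 0 = i) :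
    (A.submatrix r c).det =
      ∑ j : Fin (k + 1),
        (-1) ^ (j : ℕ) * A i (c j) * (S.submatrix (r ∘ Fin.succ) (c ∘ j.succAbove)).det := by
  -- `B`: the block `A[r, c]` with the rows `1, …, k` replaced by those of `S[r, c]`
  set B : Matrix (Fin (k + 1)) (Fin (k + 1)) K :=
    Matrix.of fun t j =>
      Fin.cases (motive := fun _ => K) (A i (c j)) (fun s => S (r s.succ) (c j)) t
    with hB_def
  have hB : (A.submatrix r c).det = B.det := by
    refine det_eq_of_forall_row_eq_smul_add_const
      (fun t : Fin (k + 1) =>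
        Fin.cases (motive := fun _ => K) (0 : K) (fun s => A (r s.succ) i * q) t)
      0 (by simp) fun t j => ?_
    refine Fin.cases ?_ (fun s => ?_) t
    · simp [hB_def, hr]
    · simp only [hB_def, submatrix_apply, of_apply, Fin.cases_succ, Fin.cases_zero, hS]
      ring
  rw [hB, det_succ_row_zero]
  refine Finset.sum_congr rfl fun j _ => ?_
  have h0 : B 0 j = A i (c j) := by simp [hB_def]
  have h1 : B.submatrix Fin.succ j.succAbove = S.submatrix (r ∘ Fin.succ) (c ∘ j.succAbove) := by
    ext t u
    simp [hB_def]
  rw [h0, h1]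

/-- [folklore] After the elimination step the pivot column vanishes. -/
private theorem elim_apply_pivot_col (A S : Matrix n n K) (i : n) (q : K)
    (hS : ∀ x y, S x y = A x y - A x i * q * A i y) (hq : A i i * q = 1) (x : n) : S x i = 0 := by
  rw [hS, mul_assoc, mul_comm q, hq, mul_one, sub_self]

/-- [folklore] If the pivot row `i = r 0` is also one of the columns, `c j₀ = i`, only one term
of the expansion survives: `det A[r, c] = (-1)^{j₀} A i i · det S[r ∘ succ, c ∘ j₀.succAbove]`. -/
private theorem det_submatrix_eq_of_col_eq_pivot (A S : Matrix n n K) (i : n) (q : K)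
    (hS : ∀ x y, S x y = A x y - A x i * q * A i y) (hq : A i i * q = 1)
    (r c : Fin (k + 1) → n) (hr : r 0 = i) {j₀ : Fin (k + 1)} (hc : c j₀ = i) :
    (A.submatrix r c).det =
      (-1) ^ (j₀ : ℕ) * A i i * (S.submatrix (r ∘ Fin.succ) (c ∘ j₀.succAbove)).det := by
  rw [det_submatrix_eq_sum_elim A S i q hS r c hr, Finset.sum_eq_single j₀, hc]
  · intro j _ hj
    obtain ⟨z, hz⟩ := Fin.exists_succAbove_eq (Ne.symm hj)
    rw [det_eq_zero_of_column_eq_zero z fun t => ?_, mul_zero]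
    simp [hz, hc, elim_apply_pivot_col A S i q hS hq]
  · exact fun h => absurd (Finset.mem_univ j₀) h

end CommRing

section NormedField

variable {K : Type*} [NormedField K] {n : Type*} [Fintype n] [DecidableEq n]

/-! ### Gaussian elimination does not decrease dominance margins -/

/-- [cite: HornJohnson2013, §6.1 Problem 6.1.P16 ("Gaussian elimination preserves strict diagonal
dominance")]; [cite: GolubVanLoan2013, §4.1.1 Theorem 4.1.1, proof via (4.1.2) (the column
version, transposed here)] The quantitative form of the maxim: one elimination step with a pivot
`E p p ≠ 0` whose ROW is diagonally dominant, `E' = E - E[:, p] (E p p)⁻¹ E[p, :]`, does not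
decrease the dominance margin of any other row:
`‖E x x‖ - Σ_{y ≠ x} ‖E x y‖ ≤ ‖E' x x‖ - Σ_{y ≠ x} ‖E' x y‖` for `x ≠ p` (no dominance of row `x`
is assumed). -/
theorem norm_diag_sub_sum_erase_norm_le_elim (E : Matrix n n K) {p : n} (hγ : E p p ≠ 0)
    (hp : ∑ y ∈ univ.erase p, ‖E p y‖ ≤ ‖E p p‖) {x : n} (hx : x ≠ p) :
    ‖E x x‖ - ∑ y ∈ univ.erase x, ‖E x y‖ ≤
      ‖E x x - E x p * (E p p)⁻¹ * E p x‖ -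
        ∑ y ∈ univ.erase x, ‖E x y - E x p * (E p p)⁻¹ * E p y‖ := by
  have hγ' : 0 < ‖E p p‖ := norm_pos_iff.mpr hγ
  have hp_mem : p ∈ univ.erase x := mem_erase.mpr ⟨Ne.symm hx, mem_univ p⟩
  have hx_mem : x ∈ univ.erase p := mem_erase.mpr ⟨hx, mem_univ x⟩
  have hpp : E x p - E x p * (E p p)⁻¹ * E p p = 0 := by
    rw [mul_assoc, inv_mul_cancel₀ hγ, mul_one, sub_self]
  rw [← Finset.add_sum_erase _ (fun y => ‖E x y - E x p * (E p p)⁻¹ * E p y‖) hp_mem, hpp,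
    norm_zero, zero_add, ← Finset.add_sum_erase _ (fun y => ‖E x y‖) hp_mem]
  set T := (univ.erase x).erase p with hT
  have h1 : ∑ y ∈ T, ‖E x y - E x p * (E p p)⁻¹ * E p y‖ ≤
      ∑ y ∈ T, ‖E x y‖ + ‖E x p‖ / ‖E p p‖ * ∑ y ∈ T, ‖E p y‖ := by
    calc ∑ y ∈ T, ‖E x y - E x p * (E p p)⁻¹ * E p y‖
        ≤ ∑ y ∈ T, (‖E x y‖ + ‖E x p‖ / ‖E p p‖ * ‖E p y‖) :=
          Finset.sum_le_sum fun y _ => by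
            calc ‖E x y - E x p * (E p p)⁻¹ * E p y‖
                ≤ ‖E x y‖ + ‖E x p * (E p p)⁻¹ * E p y‖ := norm_sub_le _ _
              _ = ‖E x y‖ + ‖E x p‖ / ‖E p p‖ * ‖E p y‖ := by
                  rw [norm_mul, norm_mul, norm_inv, div_eq_mul_inv]
      _ = ∑ y ∈ T, ‖E x y‖ + ‖E x p‖ / ‖E p p‖ * ∑ y ∈ T, ‖E p y‖ := by
          rw [Finset.sum_add_distrib, Finset.mul_sum]
  have h3 : ∑ y ∈ T, ‖E p y‖ + ‖E p x‖ ≤ ‖E p p‖ := by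
    rw [add_comm, hT, Finset.erase_right_comm,
      Finset.add_sum_erase _ (fun y => ‖E p y‖) hx_mem]
    exact hp
  have h4 : ‖E x x‖ - ‖E x p‖ * ‖E p x‖ / ‖E p p‖ ≤ ‖E x x - E x p * (E p p)⁻¹ * E p x‖ := by
    have := norm_sub_norm_le (E x x) (E x p * (E p p)⁻¹ * E p x)
    rw [norm_mul, norm_mul, norm_inv] at this
    convert this using 2
    ring
  have h5 : ‖E x p‖ / ‖E p p‖ * ∑ y ∈ T, ‖E p y‖ ≤ ‖E x p‖ / ‖E p p‖ * (‖E p p‖ - ‖E p x‖) :=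
    mul_le_mul_of_nonneg_left (by linarith) (by positivity)
  have h6 : ‖E x p‖ / ‖E p p‖ * (‖E p p‖ - ‖E p x‖) = ‖E x p‖ - ‖E x p‖ * ‖E p x‖ / ‖E p p‖ := by
    field_simp
  linarith

/-- [cite: HornJohnson2013, §6.1 Problem 6.1.P16 (b) ("Show that `C` (and hence `A′`) is strictly
diagonally dominant")]; [cite: GolubVanLoan2013, §4.1.1 Theorem 4.1.1] Strict row diagonal
dominance is inherited under one elimination step with a pivot `E p p ≠ 0` in a diagonally
dominant row: `Σ_{y ≠ x} ‖E' x y‖ < ‖E' x x‖` for every strictly dominant row `x ≠ p` (the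
non-strict companion is
`Literature.LinearAlgebra.Matrix.sum_erase_norm_sub_mul_inv_mul_le_norm`). -/
theorem sum_erase_norm_sub_mul_inv_mul_lt_norm (E : Matrix n n K) {p : n} (hγ : E p p ≠ 0)
    (hp : ∑ y ∈ univ.erase p, ‖E p y‖ ≤ ‖E p p‖) {x : n} (hx : x ≠ p)
    (hEx : ∑ y ∈ univ.erase x, ‖E x y‖ < ‖E x x‖) :
    ∑ y ∈ univ.erase x, ‖E x y - E x p * (E p p)⁻¹ * E p y‖ <
      ‖E x x - E x p * (E p p)⁻¹ * E p x‖ := by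
  have := norm_diag_sub_sum_erase_norm_le_elim E hγ hp hx
  linarith

/-! ### Reindexing sums along injective index maps -/

/-- [folklore] `Σ_{u ≠ t} f (r u) ≤ Σ_{y ≠ r t} f y` for an injective index map `r` and `f ≥ 0`. -/
private theorem sum_erase_comp_le {ι : Type*} [Fintype ι] [DecidableEq ι] {r : ι → n}
    (hr : Function.Injective r) (f : n → ℝ) (hf : ∀ y, 0 ≤ f y) (t : ι) :
    ∑ u ∈ univ.erase t, f (r u) ≤ ∑ y ∈ univ.erase (r t), f y := by
  rw [← Finset.sum_image (f := f) fun a _ b _ h => hr h]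
  refine Finset.sum_le_sum_of_subset_of_nonneg (fun y hy => ?_) fun y _ _ => hf y
  obtain ⟨u, hu, rfl⟩ := Finset.mem_image.mp hy
  exact mem_erase.mpr ⟨fun h => (mem_erase.mp hu).1 (hr h), mem_univ _⟩

/-- [folklore] `Σ_j f (c j) ≤ Σ_{y ≠ i} f y` for an injective index map `c` avoiding `i` and
`f ≥ 0`. -/
private theorem sum_comp_le_sum_erase {ι : Type*} [Fintype ι] {c : ι → n}
    (hc : Function.Injective c) {i : n} (hci : ∀ j, c j ≠ i) (f : n → ℝ) (hf : ∀ y, 0 ≤ f y) :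
    ∑ j, f (c j) ≤ ∑ y ∈ univ.erase i, f y := by
  rw [← Finset.sum_image (f := f) fun a _ b _ h => hc h]
  refine Finset.sum_le_sum_of_subset_of_nonneg (fun y hy => ?_) fun y _ _ => hf y
  obtain ⟨j, -, rfl⟩ := Finset.mem_image.mp hy
  exact mem_erase.mpr ⟨hci j, mem_univ _⟩

/-! ### Theorem 4: `‖det A[r, c]‖ ≤ ‖det A[r, r]‖` -/

omit [Fintype n] [DecidableEq n] in
/-- [folklore] The first-row bound after elimination:
`‖det A[r, c]‖ ≤ Σ_j ‖A i (c j)‖ · ‖det S[r ∘ succ, c ∘ j.succAbove]‖`. -/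
private theorem norm_det_submatrix_le_sum_elim {k : ℕ} (A S : Matrix n n K) (i : n) (q : K)
    (hS : ∀ x y, S x y = A x y - A x i * q * A i y) (r c : Fin (k + 1) → n) (hr : r 0 = i) :
    ‖(A.submatrix r c).det‖ ≤
      ∑ j : Fin (k + 1), ‖A i (c j)‖ * ‖(S.submatrix (r ∘ Fin.succ) (c ∘ j.succAbove)).det‖ := by
  rw [det_submatrix_eq_sum_elim A S i q hS r c hr]
  refine (norm_sum_le _ _).trans (le_of_eq (Finset.sum_congr rfl fun j _ => ?_))
  rw [norm_mul, norm_mul, norm_pow, norm_neg, norm_one, one_pow, one_mul]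

/-- [folklore] The induction behind Theorem 4 (all matrices at once, index maps `Fin k → n`):
if the rows `r t` of `A` are diagonally dominant and pairwise distinct, then
`‖det A[r, c]‖ ≤ ‖det A[r, r]‖` for every `c`. -/
private theorem norm_det_submatrix_le_aux :
    ∀ (k : ℕ) (A : Matrix n n K) (r c : Fin k → n), Function.Injective r →
      (∀ t, ∑ y ∈ univ.erase (r t), ‖A (r t) y‖ ≤ ‖A (r t) (r t)‖) →
      ‖(A.submatrix r c).det‖ ≤ ‖(A.submatrix r r).det‖ := by
  intro k
  induction k with
  | zero =>
    intro A r c _ _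
    simp [det_fin_zero]
  | succ k ih =>
    intro A r c hr hA
    obtain ⟨i, hi⟩ : ∃ i, r 0 = i := ⟨r 0, rfl⟩
    have hA0 : ∑ y ∈ univ.erase i, ‖A i y‖ ≤ ‖A i i‖ := by
      rw [← hi]
      exact hA 0
    by_cases hii : A i i = 0
    · -- the pivot row vanishes, hence so does the minor
      have hrow : ∀ y, A i y = 0 := by
        intro y
        rcases eq_or_ne y i with rfl | hy
        · exact hii
        · rw [hii, norm_zero] at hA0
          have := (Finset.sum_eq_zero_iff_of_nonneg fun _ _ => norm_nonneg _).mp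
            (le_antisymm hA0 (Finset.sum_nonneg fun _ _ => norm_nonneg _)) y
            (mem_erase.mpr ⟨hy, mem_univ y⟩)
          exact norm_eq_zero.mp this
      rw [det_eq_zero_of_row_eq_zero 0 fun j => by simp [hi, hrow], norm_zero]
      exact norm_nonneg _
    have hq : A i i * (A i i)⁻¹ = 1 := mul_inv_cancel₀ hii
    obtain ⟨S, hS⟩ : ∃ S : Matrix n n K, ∀ x y, S x y = A x y - A x i * (A i i)⁻¹ * A i y :=
      ⟨Matrix.of fun x y => A x y - A x i * (A i i)⁻¹ * A i y, fun _ _ => rfl⟩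
    have hr' : Function.Injective (r ∘ Fin.succ) := hr.comp (Fin.succ_injective _)
    have hne : ∀ t : Fin k, r t.succ ≠ i := fun t h => Fin.succ_ne_zero t (hr (h.trans hi.symm))
    have hS_le : ∀ t, ∑ y ∈ univ.erase ((r ∘ Fin.succ) t), ‖S ((r ∘ Fin.succ) t) y‖ ≤
        ‖S ((r ∘ Fin.succ) t) ((r ∘ Fin.succ) t)‖ := by
      intro t
      have h1 := norm_diag_sub_sum_erase_norm_le_elim A hii hA0 (hne t)
      have h2 := hA t.succ
      simp only [Function.comp_apply, hS]
      linarith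
    have hprinc : (A.submatrix r r).det =
        A i i * (S.submatrix (r ∘ Fin.succ) (r ∘ Fin.succ)).det := by
      simpa using det_submatrix_eq_of_col_eq_pivot A S i _ hS hq r r hi (j₀ := 0) hi
    rw [hprinc, norm_mul]
    by_cases hci : ∃ j₀, c j₀ = i
    · -- the pivot column is one of the chosen columns
      obtain ⟨j₀, hj₀⟩ := hci
      rw [det_submatrix_eq_of_col_eq_pivot A S i _ hS hq r c hi hj₀, norm_mul, norm_mul,
        norm_pow, norm_neg, norm_one, one_pow, one_mul]
      exact mul_le_mul_of_nonneg_left (ih S _ _ hr' hS_le) (norm_nonneg _)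
    · have hci' : ∀ j, c j ≠ i := fun j h => hci ⟨j, h⟩
      by_cases hc : Function.Injective c
      swap
      · obtain ⟨j, j', hjj', hjne⟩ := Function.not_injective_iff.mp hc
        rw [det_zero_of_column_eq hjne (fun t => by simp [hjj']), norm_zero]
        exact mul_nonneg (norm_nonneg _) (norm_nonneg _)
      calc ‖(A.submatrix r c).det‖
          ≤ ∑ j, ‖A i (c j)‖ * ‖(S.submatrix (r ∘ Fin.succ) (c ∘ j.succAbove)).det‖ :=
            norm_det_submatrix_le_sum_elim A S i _ hS r c hi
        _ ≤ ∑ j, ‖A i (c j)‖ * ‖(S.submatrix (r ∘ Fin.succ) (r ∘ Fin.succ)).det‖ :=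
            Finset.sum_le_sum fun j _ =>
              mul_le_mul_of_nonneg_left (ih S _ _ hr' hS_le) (norm_nonneg _)
        _ = (∑ j, ‖A i (c j)‖) * ‖(S.submatrix (r ∘ Fin.succ) (r ∘ Fin.succ)).det‖ := by
            rw [Finset.sum_mul]
        _ ≤ (∑ y ∈ univ.erase i, ‖A i y‖) * ‖(S.submatrix (r ∘ Fin.succ) (r ∘ Fin.succ)).det‖ :=
            mul_le_mul_of_nonneg_right
              (sum_comp_le_sum_erase hc hci' (fun y => ‖A i y‖) fun _ => norm_nonneg _)
              (norm_nonneg _)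
        _ ≤ ‖A i i‖ * ‖(S.submatrix (r ∘ Fin.succ) (r ∘ Fin.succ)).det‖ :=
            mul_le_mul_of_nonneg_right hA0 (norm_nonneg _)

/-- [cite: CortinovisKressnerMassei2020, §2.2 Theorem 4, inequality (2.3)
(`|det(A(I, J))| ≤ |det(A(I, I))|`)] The row-local form: if the rows `r t` of `A` are diagonally
dominant (`Σ_{y ≠ r t} ‖A (r t) y‖ ≤ ‖A (r t) (r t)‖`; nothing is assumed on the other rows), then
every block on these rows has volume at most that of the principal block:
`‖det A[r, c]‖ ≤ ‖det A[r, r]‖` (for a non-injective `r` both sides vanish). -/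
theorem norm_det_submatrix_le_of_sum_erase_le {ι : Type*} [Fintype ι] [DecidableEq ι]
    (A : Matrix n n K) (r c : ι → n)
    (hr : ∀ t, ∑ y ∈ univ.erase (r t), ‖A (r t) y‖ ≤ ‖A (r t) (r t)‖) :
    ‖(A.submatrix r c).det‖ ≤ ‖(A.submatrix r r).det‖ := by
  by_cases hinj : Function.Injective r
  swap
  · obtain ⟨t, t', htt', hne⟩ := Function.not_injective_iff.mp hinj
    rw [det_zero_of_row_eq hne (funext fun j => by simp [htt']), norm_zero]
    exact norm_nonneg _
  set e := Fintype.equivFin ι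
  rw [← det_submatrix_equiv_self e.symm (A.submatrix r c),
    ← det_submatrix_equiv_self e.symm (A.submatrix r r), submatrix_submatrix, submatrix_submatrix]
  exact norm_det_submatrix_le_aux _ A _ _ (hinj.comp e.symm.injective) fun t => hr (e.symm t)

/-- [cite: CortinovisKressnerMassei2020, §2.2 Theorem 4, inequality (2.3) ("The result of the
theorem follows if we can prove `|det(A(I, J))| ≤ |det(A(I, I))|`"; proved there for strictly DD
`A` via `A = LU` and Lemma 3, "the DD case follows by a continuity argument")];
[cite: HornJohnson2013, §6.1 Definition 6.1.9] For a (row) DIAGONALLY DOMINANT matrix over a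
normed field every `k × k` block has volume at most that of the principal block on the same rows:
`‖det A[r, c]‖ ≤ ‖det A[r, r]‖` for all `r c : ι → n`. -/
theorem norm_det_submatrix_le_of_rowDiagDominant {ι : Type*} [Fintype ι] [DecidableEq ι]
    {A : Matrix n n K} (hA : ∀ i, ∑ j ∈ univ.erase i, ‖A i j‖ ≤ ‖A i i‖) (r c : ι → n) :
    ‖(A.submatrix r c).det‖ ≤ ‖(A.submatrix r r).det‖ :=
  norm_det_submatrix_le_of_sum_erase_le A r c fun t => hA (r t)

/-- [cite: CortinovisKressnerMassei2020, §2.2 Theorem 4 with Definition 2 (doubly DD: "both `A`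
and `A^*` are DD"; the column version by transposition)] For a COLUMN diagonally dominant matrix
(`Σ_{i ≠ j} ‖A i j‖ ≤ ‖A j j‖` for every column `j`) every block has volume at most that of the
principal block on the same columns: `‖det A[r, c]‖ ≤ ‖det A[c, c]‖`. -/
theorem norm_det_submatrix_le_of_colDiagDominant {ι : Type*} [Fintype ι] [DecidableEq ι]
    {A : Matrix n n K} (hA : ∀ j, ∑ i ∈ univ.erase j, ‖A i j‖ ≤ ‖A j j‖) (r c : ι → n) :
    ‖(A.submatrix r c).det‖ ≤ ‖(A.submatrix c c).det‖ := by
  rw [← det_transpose, transpose_submatrix, ← det_transpose (A.submatrix c c),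
    transpose_submatrix]
  exact norm_det_submatrix_le_of_rowDiagDominant (A := Aᵀ) (fun i => by simpa using hA i) c r

/-- [cite: CortinovisKressnerMassei2020, §2.2 Theorem 4 ("Let `A ∈ ℝ^{n×n}` be a diagonally
dominant matrix and `1 ≤ k ≤ n`. Then the maximum volume `k × k` submatrix of `A` can be chosen to
be a principal submatrix.")] Over any normed field and for any finite index type `ι` (`k = |ι|`):
some principal block `A[r, r]` has maximal volume among ALL blocks `A[r', c']`, `r' c' : ι → n`. -/
theorem exists_principal_volume_maximal_of_rowDiagDominant {ι : Type*} [Fintype ι]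
    [DecidableEq ι] [Nonempty n] {A : Matrix n n K}
    (hA : ∀ i, ∑ j ∈ univ.erase i, ‖A i j‖ ≤ ‖A i i‖) :
    ∃ r : ι → n, ∀ r' c' : ι → n, ‖(A.submatrix r' c').det‖ ≤ ‖(A.submatrix r r).det‖ := by
  obtain ⟨r, hr⟩ := Finite.exists_max fun r : ι → n => ‖(A.submatrix r r).det‖
  exact ⟨r, fun r' c' => (norm_det_submatrix_le_of_rowDiagDominant hA r' c').trans (hr r')⟩

/-- [cite: CortinovisKressnerMassei2020, §2.2 Theorem 4 (proof: "`A(I, J)` can be replaced by a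
principal submatrix without decreasing the volume", as in §2.1 Theorem 1)] For a row diagonally
dominant matrix, a principal block whose volume is maximal AMONG PRINCIPAL BLOCKS of its size has
maximal volume among all blocks of its size (so the search for a maximum volume block, e.g. the
hypothesis `hmax` of `Literature.LinearAlgebra.Matrix.abs_sub_crossInterp_le_of_volume_maximal`,
may be restricted to principal blocks). -/
theorem norm_det_submatrix_le_of_forall_principal_le_of_rowDiagDominant {ι : Type*} [Fintype ι]
    [DecidableEq ι] {A : Matrix n n K} (hA : ∀ i, ∑ j ∈ univ.erase i, ‖A i j‖ ≤ ‖A i i‖)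
    {r : ι → n} (hmax : ∀ r' : ι → n, ‖(A.submatrix r' r').det‖ ≤ ‖(A.submatrix r r).det‖)
    (r' c' : ι → n) : ‖(A.submatrix r' c').det‖ ≤ ‖(A.submatrix r r).det‖ :=
  (norm_det_submatrix_le_of_rowDiagDominant hA r' c').trans (hmax r')

/-! ### Lemma 3 (strict diagonal dominance): `‖det A[r, c]‖ < ‖det A[r, r]‖` for `I ≠ J` -/

/-- [cite: HornJohnson2013, §6.1 Theorem 6.1.10 (a) (Levy–Desplanques) and Problem 6.1.P16 (a)
("each of the leading principal submatrices of `A` is nonsingular")] A principal block on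
pairwise distinct, strictly diagonally dominant rows is nonsingular: `det A[r, r] ≠ 0` (the block
is itself strictly row diagonally dominant; Mathlib's `det_ne_zero_of_sum_row_lt_diag`). -/
theorem det_submatrix_ne_zero_of_sum_erase_lt {ι : Type*} [Fintype ι] [DecidableEq ι]
    (A : Matrix n n K) {r : ι → n} (hinj : Function.Injective r)
    (hr : ∀ t, ∑ y ∈ univ.erase (r t), ‖A (r t) y‖ < ‖A (r t) (r t)‖) :
    (A.submatrix r r).det ≠ 0 :=
  det_ne_zero_of_sum_row_lt_diag fun t =>
    (sum_erase_comp_le hinj (fun y => ‖A (r t) y‖) (fun _ => norm_nonneg _) t).trans_lt (hr t)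

/-- [cite: HornJohnson2013, §6.1 Theorem 6.1.10 (a) (Levy–Desplanques theorem) with Problem
6.1.P16 (a)] Every principal block `A[r, r]` (`r` injective) of a strictly row diagonally
dominant matrix is nonsingular. -/
theorem det_submatrix_ne_zero_of_rowStrictDiagDominant {ι : Type*} [Fintype ι] [DecidableEq ι]
    {A : Matrix n n K} (hA : ∀ i, ∑ j ∈ univ.erase i, ‖A i j‖ < ‖A i i‖) {r : ι → n}
    (hinj : Function.Injective r) : (A.submatrix r r).det ≠ 0 :=
  det_submatrix_ne_zero_of_sum_erase_lt A hinj fun t => hA (r t)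

/-- [folklore] The induction behind Lemma 3 (all matrices at once): if the rows `r t` of `A` are
strictly diagonally dominant and pairwise distinct and some row index `r t` is not a column index,
then `‖det A[r, c]‖ < ‖det A[r, r]‖`. -/
private theorem norm_det_submatrix_lt_aux :
    ∀ (k : ℕ) (A : Matrix n n K) (r c : Fin k → n), Function.Injective r →
      (∀ t, ∑ y ∈ univ.erase (r t), ‖A (r t) y‖ < ‖A (r t) (r t)‖) →
      (∃ t, ∀ j, c j ≠ r t) → ‖(A.submatrix r c).det‖ < ‖(A.submatrix r r).det‖ := by
  intro k
  induction k with
  | zero =>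
    rintro A r c - - ⟨t, -⟩
    exact t.elim0
  | succ k ih =>
    rintro A r c hr hA ⟨t₀, ht₀⟩
    obtain ⟨i, hi⟩ : ∃ i, r 0 = i := ⟨r 0, rfl⟩
    have hA0 : ∑ y ∈ univ.erase i, ‖A i y‖ < ‖A i i‖ := by
      rw [← hi]
      exact hA 0
    have hii : A i i ≠ 0 :=
      norm_pos_iff.mp ((Finset.sum_nonneg fun _ _ => norm_nonneg _).trans_lt hA0)
    have hq : A i i * (A i i)⁻¹ = 1 := mul_inv_cancel₀ hii
    obtain ⟨S, hS⟩ : ∃ S : Matrix n n K, ∀ x y, S x y = A x y - A x i * (A i i)⁻¹ * A i y :=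
      ⟨Matrix.of fun x y => A x y - A x i * (A i i)⁻¹ * A i y, fun _ _ => rfl⟩
    have hr' : Function.Injective (r ∘ Fin.succ) := hr.comp (Fin.succ_injective _)
    have hne : ∀ t : Fin k, r t.succ ≠ i := fun t h => Fin.succ_ne_zero t (hr (h.trans hi.symm))
    have hS_lt : ∀ t, ∑ y ∈ univ.erase ((r ∘ Fin.succ) t), ‖S ((r ∘ Fin.succ) t) y‖ <
        ‖S ((r ∘ Fin.succ) t) ((r ∘ Fin.succ) t)‖ := by
      intro t
      have h1 := norm_diag_sub_sum_erase_norm_le_elim A hii hA0.le (hne t)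
      have h2 := hA t.succ
      simp only [Function.comp_apply, hS]
      linarith
    have hS_le : ∀ t, ∑ y ∈ univ.erase ((r ∘ Fin.succ) t), ‖S ((r ∘ Fin.succ) t) y‖ ≤
        ‖S ((r ∘ Fin.succ) t) ((r ∘ Fin.succ) t)‖ := fun t => (hS_lt t).le
    have hD : 0 < ‖(S.submatrix (r ∘ Fin.succ) (r ∘ Fin.succ)).det‖ :=
      norm_pos_iff.mpr (det_submatrix_ne_zero_of_sum_erase_lt S hr' hS_lt)
    have hprinc : (A.submatrix r r).det =
        A i i * (S.submatrix (r ∘ Fin.succ) (r ∘ Fin.succ)).det := by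
      simpa using det_submatrix_eq_of_col_eq_pivot A S i _ hS hq r r hi (j₀ := 0) hi
    rw [hprinc, norm_mul]
    by_cases hci : ∃ j₀, c j₀ = i
    · -- the pivot column is one of the chosen columns; the missing row index is a later one
      obtain ⟨j₀, hj₀⟩ := hci
      have ht₀0 : t₀ ≠ 0 := by
        rintro rfl
        exact ht₀ j₀ (hj₀.trans hi.symm)
      obtain ⟨s, rfl⟩ := Fin.exists_succ_eq.mpr ht₀0
      rw [det_submatrix_eq_of_col_eq_pivot A S i _ hS hq r c hi hj₀, norm_mul, norm_mul,
        norm_pow, norm_neg, norm_one, one_pow, one_mul]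
      exact mul_lt_mul_of_pos_left (ih S _ _ hr' hS_lt ⟨s, fun j => ht₀ _⟩)
        (norm_pos_iff.mpr hii)
    · have hci' : ∀ j, c j ≠ i := fun j h => hci ⟨j, h⟩
      by_cases hc : Function.Injective c
      swap
      · obtain ⟨j, j', hjj', hjne⟩ := Function.not_injective_iff.mp hc
        rw [det_zero_of_column_eq hjne (fun t => by simp [hjj']), norm_zero]
        exact mul_pos (norm_pos_iff.mpr hii) hD
      calc ‖(A.submatrix r c).det‖
          ≤ ∑ j, ‖A i (c j)‖ * ‖(S.submatrix (r ∘ Fin.succ) (c ∘ j.succAbove)).det‖ :=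
            norm_det_submatrix_le_sum_elim A S i _ hS r c hi
        _ ≤ ∑ j, ‖A i (c j)‖ * ‖(S.submatrix (r ∘ Fin.succ) (r ∘ Fin.succ)).det‖ :=
            Finset.sum_le_sum fun j _ =>
              mul_le_mul_of_nonneg_left (norm_det_submatrix_le_aux k S _ _ hr' hS_le)
                (norm_nonneg _)
        _ = (∑ j, ‖A i (c j)‖) * ‖(S.submatrix (r ∘ Fin.succ) (r ∘ Fin.succ)).det‖ := by
            rw [Finset.sum_mul]
        _ ≤ (∑ y ∈ univ.erase i, ‖A i y‖) * ‖(S.submatrix (r ∘ Fin.succ) (r ∘ Fin.succ)).det‖ :=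
            mul_le_mul_of_nonneg_right
              (sum_comp_le_sum_erase hc hci' (fun y => ‖A i y‖) fun _ => norm_nonneg _)
              (norm_nonneg _)
        _ < ‖A i i‖ * ‖(S.submatrix (r ∘ Fin.succ) (r ∘ Fin.succ)).det‖ :=
            mul_lt_mul_of_pos_right hA0 hD

/-- [cite: CortinovisKressnerMassei2020, §2.2 Lemma 3 ("Let `T` be a strictly DD, upper triangular
matrix. Then `|det(T(I, J))| < |det(T(I, I))|` holds for every `I, J ⊆ {1, …, n}` with `|I| = |J|`
and `I ≠ J`"; the triangularity is not needed) and proof of Theorem 4 (strictly DD case)] The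
row-local strict form: if the rows `r t` of `A` (`r` injective) are STRICTLY diagonally dominant
and the column index set differs from the row index set, `Set.range r ≠ Set.range c`, then
`‖det A[r, c]‖ < ‖det A[r, r]‖`. -/
theorem norm_det_submatrix_lt_of_sum_erase_lt {ι : Type*} [Fintype ι] [DecidableEq ι]
    (A : Matrix n n K) {r : ι → n} (hinj : Function.Injective r)
    (hr : ∀ t, ∑ y ∈ univ.erase (r t), ‖A (r t) y‖ < ‖A (r t) (r t)‖) {c : ι → n}
    (hrc : Set.range r ≠ Set.range c) :
    ‖(A.submatrix r c).det‖ < ‖(A.submatrix r r).det‖ := by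
  -- some row index is not a column index (else `range r ⊆ range c`, and the two finite sets have
  -- `|range c| ≤ |ι| = |range r|` elements)
  obtain ⟨t₀, ht₀⟩ : ∃ t, ∀ j, c j ≠ r t := by
    by_contra! h
    have hsub : univ.image r ⊆ univ.image c := by
      intro y hy
      obtain ⟨t, -, rfl⟩ := mem_image.mp hy
      obtain ⟨j, hj⟩ := h t
      exact mem_image.mpr ⟨j, mem_univ _, hj⟩
    have heq : univ.image r = univ.image c :=
      eq_of_subset_of_card_le hsub
        (card_image_le.trans (card_image_of_injective _ hinj).symm.le)
    apply hrc
    have := congrArg (fun s : Finset n => (s : Set n)) heq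
    simpa [coe_image] using this
  set e := Fintype.equivFin ι
  rw [← det_submatrix_equiv_self e.symm (A.submatrix r c),
    ← det_submatrix_equiv_self e.symm (A.submatrix r r), submatrix_submatrix, submatrix_submatrix]
  exact norm_det_submatrix_lt_aux _ A _ _ (hinj.comp e.symm.injective) (fun t => hr (e.symm t))
    ⟨e t₀, fun j => by simpa [e] using ht₀ (e.symm j)⟩

/-- [cite: CortinovisKressnerMassei2020, §2.2 Lemma 3 and proof of Theorem 4 (for strictly DD `A`
and `I ≠ J`: `|det A(I, J)| = |det U(I, J)| < |det U(I, I)| = |det A(I, I)|`)];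
[cite: HornJohnson2013, §6.1 Definition 6.1.9 (strict diagonal dominance)] For a STRICTLY row
diagonally dominant matrix over a normed field, an injective row selection `r` and any column
selection with a different index set, `Set.range r ≠ Set.range c`, the principal block has
strictly larger volume: `‖det A[r, c]‖ < ‖det A[r, r]‖` (Lemma 3 of the paper is the case of an
upper triangular matrix; upper triangularity is not needed). -/
theorem norm_det_submatrix_lt_of_rowStrictDiagDominant {ι : Type*} [Fintype ι] [DecidableEq ι]
    {A : Matrix n n K} (hA : ∀ i, ∑ j ∈ univ.erase i, ‖A i j‖ < ‖A i i‖) {r : ι → n}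
    (hinj : Function.Injective r) {c : ι → n} (hrc : Set.range r ≠ Set.range c) :
    ‖(A.submatrix r c).det‖ < ‖(A.submatrix r r).det‖ :=
  norm_det_submatrix_lt_of_sum_erase_lt A hinj (fun t => hA (r t)) hrc

/-- [cite: CortinovisKressnerMassei2020, §2.2 Lemma 3 / Theorem 4 (strictly DD case: the strict
inequality `|det A(I, J)| < |det A(I, I)|` for `I ≠ J`)] Consequently, for a strictly row
diagonally dominant matrix a block `A[r, c]` (`r` injective) whose volume is maximal among the
blocks ON THE SAME ROWS is principal as a set of indices: `Set.range c = Set.range r`.  In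
particular every maximum volume `k × k` submatrix of a strictly DD matrix is principal. -/
theorem range_eq_range_of_volume_maximal_of_rowStrictDiagDominant {ι : Type*} [Fintype ι]
    [DecidableEq ι] {A : Matrix n n K} (hA : ∀ i, ∑ j ∈ univ.erase i, ‖A i j‖ < ‖A i i‖)
    {r c : ι → n} (hinj : Function.Injective r)
    (hmax : ∀ c' : ι → n, ‖(A.submatrix r c').det‖ ≤ ‖(A.submatrix r c).det‖) :
    Set.range c = Set.range r := by
  by_contra h
  exact not_le.mpr (norm_det_submatrix_lt_of_rowStrictDiagDominant hA hinj (Ne.symm h))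
    (hmax r)

/-! ### The case `k = n - 1`: columns of the adjugate and of the inverse -/

/-- [folklore] Transport of `Matrix.adjugate_fin_succ_eq_det_submatrix` to an arbitrary finite
index type: `‖adj A i j‖ = ‖det A[{j}ᶜ, {i}ᶜ]‖` with the complements enumerated through
`e : n ≃ Fin (m + 1)`. -/
private theorem norm_adjugate_apply_eq {m : ℕ} (A : Matrix n n K) (e : n ≃ Fin (m + 1))
    (i j : n) : ‖A.adjugate i j‖ =
      ‖(A.submatrix (e.symm ∘ (e j).succAbove) (e.symm ∘ (e i).succAbove)).det‖ := by
  have hA : A.adjugate = ((A.submatrix e.symm e.symm).adjugate).submatrix e e := by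
    rw [← adjugate_submatrix_equiv_self, submatrix_submatrix]
    simp
  rw [hA, submatrix_apply, adjugate_fin_succ_eq_det_submatrix, submatrix_submatrix, norm_mul,
    norm_pow, norm_neg, norm_one, one_pow, one_mul]

omit [DecidableEq n] in
/-- [folklore] `Fintype.card n = m + 1` for some `m` as soon as `n` is inhabited. -/
private theorem exists_equiv_fin_succ (i : n) : ∃ m : ℕ, Nonempty (n ≃ Fin (m + 1)) := by
  haveI : Nonempty n := ⟨i⟩
  obtain ⟨m, hm⟩ := Nat.exists_eq_succ_of_ne_zero (Fintype.card_ne_zero (α := n))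
  exact ⟨m, ⟨(Fintype.equivFin n).trans (finCongr hm)⟩⟩

/-- [cite: CortinovisKressnerMassei2020, §2.2, remark after the proof of Theorem 4 ("For
`k = n - 1`, the result of Theorem 4 is covered in the proof of Theorem 2.5.12 in
[Horn–Johnson, *Topics in Matrix Analysis*, 1991]")] The case `k = n - 1` of Theorem 4, entrywise:
in every COLUMN of the adjugate of a row diagonally dominant matrix the diagonal entry has
maximal modulus, `‖adj A i j‖ ≤ ‖adj A j j‖` (`adj A i j = ± det A[{j}ᶜ, {i}ᶜ]`). -/
theorem norm_adjugate_apply_le_of_rowDiagDominant {A : Matrix n n K}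
    (hA : ∀ i, ∑ j ∈ univ.erase i, ‖A i j‖ ≤ ‖A i i‖) (i j : n) :
    ‖A.adjugate i j‖ ≤ ‖A.adjugate j j‖ := by
  obtain ⟨m, ⟨e⟩⟩ := exists_equiv_fin_succ i
  rw [norm_adjugate_apply_eq A e i j, norm_adjugate_apply_eq A e j j]
  exact norm_det_submatrix_le_of_rowDiagDominant hA _ _

/-- [cite: CortinovisKressnerMassei2020, §2.2, remark after the proof of Theorem 4 (`k = n - 1`:
proof of Theorem 2.5.12 of Horn–Johnson 1991; for Lemma 3, Proposition 2.1 of Peña 2004)] For a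
STRICTLY row diagonally dominant matrix the diagonal entry of each column of the adjugate
strictly dominates every other entry of that column: `‖adj A i j‖ < ‖adj A j j‖` for `i ≠ j`. -/
theorem norm_adjugate_apply_lt_of_rowStrictDiagDominant {A : Matrix n n K}
    (hA : ∀ i, ∑ j ∈ univ.erase i, ‖A i j‖ < ‖A i i‖) {i j : n} (hij : i ≠ j) :
    ‖A.adjugate i j‖ < ‖A.adjugate j j‖ := by
  obtain ⟨m, ⟨e⟩⟩ := exists_equiv_fin_succ i
  rw [norm_adjugate_apply_eq A e i j, norm_adjugate_apply_eq A e j j]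
  refine norm_det_submatrix_lt_of_rowStrictDiagDominant hA
    (e.symm.injective.comp Fin.succAbove_right_injective) fun h => ?_
  -- `i` is a row index (`i ≠ j`) but not a column index
  have hi : i ∈ Set.range (e.symm ∘ (e j).succAbove) := by
    obtain ⟨z, hz⟩ := Fin.exists_succAbove_eq (show e i ≠ e j from fun h' => hij (e.injective h'))
    exact ⟨z, by simp [hz]⟩
  rw [h] at hi
  obtain ⟨z, hz⟩ := hi
  exact Fin.succAbove_ne (e i) z (e.symm.injective (hz.trans (e.symm_apply_apply i).symm))

/-- [cite: CortinovisKressnerMassei2020, §2.2, remark after the proof of Theorem 4 (`k = n - 1`,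
Horn–Johnson 1991 Theorem 2.5.12)] In every column of the INVERSE of a row diagonally dominant
matrix the diagonal entry has maximal modulus: `‖A⁻¹ i j‖ ≤ ‖A⁻¹ j j‖` (with Mathlib's `A⁻¹ = 0`
for a singular `A` the statement is unconditional). -/
theorem norm_inv_apply_le_of_rowDiagDominant {A : Matrix n n K}
    (hA : ∀ i, ∑ j ∈ univ.erase i, ‖A i j‖ ≤ ‖A i i‖) (i j : n) : ‖A⁻¹ i j‖ ≤ ‖A⁻¹ j j‖ := by
  rw [Matrix.inv_def, Matrix.smul_apply, Matrix.smul_apply, smul_eq_mul, smul_eq_mul, norm_mul,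
    norm_mul]
  exact mul_le_mul_of_nonneg_left (norm_adjugate_apply_le_of_rowDiagDominant hA i j)
    (norm_nonneg _)

/-- [cite: CortinovisKressnerMassei2020, §2.2, remark after the proof of Theorem 4 (`k = n - 1`,
Horn–Johnson 1991 Theorem 2.5.12)]; [cite: HornJohnson2013, §6.1 Theorem 6.1.10 (a)
(Levy–Desplanques: `A` is nonsingular)] The inverse of a STRICTLY row diagonally dominant matrix
is strictly diagonally dominant of its column entries: `‖A⁻¹ i j‖ < ‖A⁻¹ j j‖` for `i ≠ j`. -/
theorem norm_inv_apply_lt_of_rowStrictDiagDominant {A : Matrix n n K}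
    (hA : ∀ i, ∑ j ∈ univ.erase i, ‖A i j‖ < ‖A i i‖) {i j : n} (hij : i ≠ j) :
    ‖A⁻¹ i j‖ < ‖A⁻¹ j j‖ := by
  rw [Matrix.inv_def, Ring.inverse_eq_inv, Matrix.smul_apply, Matrix.smul_apply, smul_eq_mul,
    smul_eq_mul, norm_mul, norm_mul]
  exact mul_lt_mul_of_pos_left (norm_adjugate_apply_lt_of_rowStrictDiagDominant hA hij)
    (norm_pos_iff.mpr (inv_ne_zero (det_ne_zero_of_sum_row_lt_diag hA)))

end NormedField

/-! ### Principal maximum-volume cross approximation of a real DD matrix -/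

section Real

variable {n ι : Type*} [Fintype n] [DecidableEq n] [Fintype ι] [DecidableEq ι] {A : Matrix n n ℝ}

/-- [cite: CortinovisKressnerMassei2020, §1 eq. (1) with §2.2 Theorem 4 ("volume maximization
yields a quasi-best low-rank approximation"; for a DD matrix the maximum volume submatrix "can be
chosen to be a principal submatrix")]; [cite: Savostyanov2014, §2 eq. (6) (the entrywise
`(r+1)²` maximal-volume bound)] PRINCIPAL MAXIMUM-VOLUME CROSS APPROXIMATION: if the real matrix
`A` is row diagonally dominant and the principal block `P = A[r, r]` (`k = |ι|`) is nonsingular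
and has maximal volume AMONG THE PRINCIPAL `k × k` BLOCKS, then the principal cross approximation
`Ã = A[:, r] P⁻¹ A[r, :]` is entrywise quasi-optimal: `|(A - Ã) i j| ≤ (k+1)² δ` for every `F` of
rank `≤ k` with `|A i j - F i j| ≤ δ` (Theorem 4 upgrades "maximal among principal blocks" to
"maximal among all blocks", which is the hypothesis of
`Literature.LinearAlgebra.Matrix.abs_sub_crossInterp_le_of_volume_maximal`). -/
theorem abs_sub_crossInterp_le_of_principal_volume_maximal_of_rowDiagDominant
    (hA : ∀ i, ∑ j ∈ univ.erase i, |A i j| ≤ |A i i|) {r : ι → n}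
    (hP : IsUnit (A.submatrix r r).det)
    (hmax : ∀ r' : ι → n, |(A.submatrix r' r').det| ≤ |(A.submatrix r r).det|)
    (F : Matrix n n ℝ) (hF : F.rank ≤ Fintype.card ι) {δ : ℝ} (hδ : ∀ i j, |A i j - F i j| ≤ δ)
    (i j : n) : |(A - crossInterp A r r) i j| ≤ (Fintype.card ι + 1 : ℝ) ^ 2 * δ := by
  refine abs_sub_crossInterp_le_of_volume_maximal A r r hP (fun r' c' => ?_) F hF hδ i j
  have hA' : ∀ i, ∑ j ∈ univ.erase i, ‖A i j‖ ≤ ‖A i i‖ := fun i => by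
    simpa only [Real.norm_eq_abs] using hA i
  have hmax' : ∀ r' : ι → n, ‖(A.submatrix r' r').det‖ ≤ ‖(A.submatrix r r).det‖ := fun r' => by
    simpa only [Real.norm_eq_abs] using hmax r'
  simpa only [Real.norm_eq_abs] using
    norm_det_submatrix_le_of_forall_principal_le_of_rowDiagDominant hA' hmax' r' c'

/-- [cite: CortinovisKressnerMassei2020, §1 eq. (1) with §2.2 Theorem 4];
[cite: Savostyanov2014, §2 eq. (6)]; [cite: HornJohnson2013, §6.1 Theorem 6.1.10 (a)] The same
for a STRICTLY row diagonally dominant real matrix, where every principal block on distinct rows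
is nonsingular (Levy–Desplanques): a principal block of maximal volume among principal blocks
gives `|(A - A[:, r] A[r, r]⁻¹ A[r, :]) i j| ≤ (k+1)² δ`. -/
theorem abs_sub_crossInterp_le_of_principal_volume_maximal_of_rowStrictDiagDominant
    (hA : ∀ i, ∑ j ∈ univ.erase i, |A i j| < |A i i|) {r : ι → n} (hinj : Function.Injective r)
    (hmax : ∀ r' : ι → n, |(A.submatrix r' r').det| ≤ |(A.submatrix r r).det|)
    (F : Matrix n n ℝ) (hF : F.rank ≤ Fintype.card ι) {δ : ℝ} (hδ : ∀ i j, |A i j - F i j| ≤ δ)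
    (i j : n) : |(A - crossInterp A r r) i j| ≤ (Fintype.card ι + 1 : ℝ) ^ 2 * δ := by
  have hA' : ∀ i, ∑ j ∈ univ.erase i, ‖A i j‖ < ‖A i i‖ := fun i => by
    simpa only [Real.norm_eq_abs] using hA i
  exact abs_sub_crossInterp_le_of_principal_volume_maximal_of_rowDiagDominant
    (fun i => (hA i).le) (isUnit_iff_ne_zero.mpr (det_submatrix_ne_zero_of_rowStrictDiagDominant
      hA' hinj)) hmax F hF hδ i j

end Real

end Literature.LinearAlgebra.Matrix
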